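import Summits.NavierStokesRegularity.NavierStokesRegularity.Theorems.AxisymmetricExtremalityAxisymmetricKatoGlobalStubSeregin2020TypeIILemma22SublevelEnergyTools
import Literature.Analysis.FluidPDE.KNSSSwirlTransport
import HarnessLib

/-!
# Seregin 2020, Lemma 2.2 (after Nazarov–Uraltseva 2012): the energy bound (3.12)
# `∫∫_{Q ∩ {Φ < l}} |∇Φ|² ≤ C l² ρ³` on sublevel sets, from the energy-inequality class

Helper toward the stub `stub_seregin2020TypeII` of the crux `AxisymmetricKatoGlobal` (= the named
fact `Literature.Analysis.FluidPDE.Seregin2020_axisymmetricSingularPoint_typeII`, Seregin 2020,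
Thm 2.1), reduced in the tree to the written-out hypothesis `hWH′` (= N–U 2012 Lemma 4.2 for the
class 𝒱). In N–U Lemma 3.3 (shrinking levels; core `shrinkingLevels_measure_le`) the analytic
input is (3.12): `∫∫_{Q_ρ^{1,θ} ∩ {V < l}} |DV|² ≤ C₁₄ l² ρ³`, "derived similarly to Lemma 3.2"
from the energy inequality (3.9) with Remark 9. This file derives it from the ENERGY-INEQUALITY
CLASS of the cell's De Giorgi skeleton (`EnergyClass` of
`Cruxes/AxisymmetricKatoGlobal/Seregin2020Lemma22ExpansionOfPositivity.lean`, written out as the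
hypothesis `hEC` — with the parenthesisation `η t₁ * (∫ x, …) + ∫∫ …` of its right-hand side),
tested with `H(τ) = ((2l - τ)₊)³` (sibling `…Lemma22SublevelEnergyTools`), `η ≡ 1` and the radial cut-off
`Θ = radialCutoff ρ ρ₁`:

* `lintegral_fderiv_sq_sublevel_le_of_energyClass` — for `0 < ρ < ρ₁ < 2R`,
  `-R² < a < t₀ ≤ 0`, `0 < l`, `2l ≤ k`:
  `∫∫_{(]a,t₀[ × B(ρ)) ∩ {Φ < l}} ‖∇Φ‖² ≤ (8/3) l² (|B̄(ρ₁)| + 4 C_g² (t₀-a)|B̄(ρ₁)|/(ρ₁-ρ)²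
    + 2 C_g I_U/(ρ₁-ρ) + 4 C_g I_ϱ/(ρ₁-ρ))`, `I_U ≥ ∫∫_{[a,t₀[×B̄(ρ₁)} |U|`,
  `I_ϱ ≥ ∫∫_{[a,t₀[×B̄(ρ₁)} 1/ϱ`, `C_g/(ρ₁-ρ) ≥ |∇Θ|`.

## References

* A. I. Nazarov, N. N. Uraltseva, St. Petersburg Math. J. 23 (2012) 93–115 = arXiv:1011.1888,
  §3, (3.9), (3.12), Remark 9. [NazarovUraltseva2012]
* G. Seregin, Anal. Math. Phys. 10 (2020), Paper 46 = arXiv:2006.04140, Lemma 2.2. [Seregin2020]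
-/


-- the problem directory repeats the summit name (D-0017); core's `dupNamespace` linter fires
set_option linter.dupNamespace false

noncomputable section

open MeasureTheory Set Function Filter Topology Metric Module
open scoped NNReal ENNReal

namespace Summit.NavierStokesRegularity.NavierStokesRegularity.Theorems.AxisymmetricKatoGlobal.EulerScaling

open Literature.Analysis.FluidPDE Literature.Analysis.FluidPDE.LeiZhang2011

/-! ### The energy bound (3.12) on sublevel sets -/

/-- **Nazarov–Uraltseva 2012, (3.12) from the energy class (Seregin's class 𝒱, Remark 9).**
Let `Φ ≥ 0` be jointly measurable, `U` a.e.-strongly measurable on the slab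
`]-R², 0[ × B(2R)`, and assume the ENERGY-INEQUALITY CLASS at the axis level `k` on that slab
(hypothesis `hEC`, = `EnergyClass Φ U k R` of the cell's De Giorgi skeleton, written out).
Let `0 < ρ < ρ₁ < 2R`, `-R² < a < t₀ ≤ 0`, `0 < l` with `2l ≤ k`, let `C_g/(ρ₁ - ρ)` bound the
gradient of the radial cut-off `Θ = radialCutoff ρ ρ₁`, and let `I_U`, `I_ϱ` be finite bounds
of `∫∫_{[a,t₀[ × B̄(ρ₁)} |U|` and `∫∫_{[a,t₀[ × B̄(ρ₁)} 1/ϱ`. Then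
`∫∫_{(]a,t₀[ × B(ρ)) ∩ {Φ < l}} ‖∇Φ‖² ≤ (8/3) l² (|B̄(ρ₁)| + 4 (C_g/(ρ₁-ρ))² (t₀ - a)|B̄(ρ₁)|
  + 2 (C_g/(ρ₁-ρ)) I_U + 4 (C_g/(ρ₁-ρ)) I_ϱ)`
(test the class with `H = ((2l-τ)₊)³`, `η ≡ 1`, `Θ`; on `B(ρ) ∩ {Φ < l}` the dissipation
density is `≥ 3l |∇Φ|²`; the right-hand side is bounded through `H ≤ 8l³`, `|∇Θ| ≤ C_g/(ρ₁-ρ)`,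
`|Θ| ≤ 1`, `|e_ϱ| ≤ 1`; finally `t₂ ↑ t₀`).
[cite: NazarovUraltseva2012, §3 (3.9), (3.12), Remark 9; Seregin2020, Lemma 2.2] -/
theorem lintegral_fderiv_sq_sublevel_le_of_energyClass
    (Φ : ℝ → EuclideanSpace ℝ (Fin 3) → ℝ)
    (U : ℝ → EuclideanSpace ℝ (Fin 3) → EuclideanSpace ℝ (Fin 3)) (k R : ℝ)
    (hΦm : Measurable (uncurry Φ)) (hΦ0 : ∀ t x, 0 ≤ Φ t x)
    (hU : AEStronglyMeasurable (uncurry U)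
      (volume.restrict (Ioo (-R ^ 2) 0 ×ˢ ball (0 : EuclideanSpace ℝ (Fin 3)) (2 * R))))
    (hEC : ∀ (H : ℝ → ℝ), ContDiff ℝ 2 H → (∀ v, deriv H v ≤ 0) → (∀ v, 0 ≤ H v) →
      (∀ v, 0 ≤ deriv (deriv H) v) → (∀ v, deriv H v ^ 2 ≤ 2 * H v * deriv (deriv H) v) →
      (∀ v, k ≤ v → H v = 0) →
      ∀ (Θ : EuclideanSpace ℝ (Fin 3) → ℝ), ContDiff ℝ 1 Θ → HasCompactSupport Θ →
        tsupport Θ ⊆ ball (0 : EuclideanSpace ℝ (Fin 3)) (2 * R) →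
      ∀ (η : ℝ → ℝ), ContDiff ℝ 1 η → (∀ s, 0 ≤ η s) →
      ∀ (t₁ t₂ : ℝ), -R ^ 2 < t₁ → t₁ ≤ t₂ → t₂ < 0 →
        ENNReal.ofReal (η t₂ * ∫ x, H (Φ t₂ x) * Θ x ^ 2) +
          ∫⁻ z in Icc t₁ t₂ ×ˢ (univ : Set (EuclideanSpace ℝ (Fin 3))), ENNReal.ofReal
            (1 / 2 * η z.1 * (deriv (deriv H) (Φ z.1 z.2) * ‖gradient (Φ z.1) z.2‖ ^ 2 *
              Θ z.2 ^ 2))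
        ≤ ENNReal.ofReal (η t₁ * (∫ x, H (Φ t₁ x) * Θ x ^ 2) +
            ∫ z in Icc t₁ t₂ ×ˢ (univ : Set (EuclideanSpace ℝ (Fin 3))),
              (4 * η z.1 * (H (Φ z.1 z.2) * ‖gradient Θ z.2‖ ^ 2) +
                η z.1 * (H (Φ z.1 z.2) * inner ℝ (U z.1 z.2) (gradient (fun y => Θ y ^ 2) z.2)) +
                η z.1 * (2 / cylRadius z.2 *
                  (H (Φ z.1 z.2) * fderiv ℝ (fun y => Θ y ^ 2) z.2 (eR z.2))) +
                |deriv η z.1| * (H (Φ z.1 z.2) * Θ z.2 ^ 2))))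
    {ρ ρ₁ a t₀ l : ℝ} (hρ : 0 < ρ) (hρ₁ : ρ < ρ₁) (hρ₁R : ρ₁ < 2 * R) (ha : -R ^ 2 < a)
    (hat : a < t₀) (ht₀ : t₀ ≤ 0) (hl : 0 < l) (hlk : 2 * l ≤ k)
    {Cg : ℝ} (hCg0 : 0 ≤ Cg)
    (hCg : ∀ x, ‖fderiv ℝ (radialCutoff ρ ρ₁ : EuclideanSpace ℝ (Fin 3) → ℝ) x‖ ≤ Cg / (ρ₁ - ρ))
    {IU Iϱ : ℝ≥0∞} (hIUfin : IU ≠ ∞) (hIϱfin : Iϱ ≠ ∞)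
    (hIU : ∫⁻ z in Ico a t₀ ×ˢ closedBall (0 : EuclideanSpace ℝ (Fin 3)) ρ₁, ‖U z.1 z.2‖ₑ ≤ IU)
    (hIϱ : ∫⁻ z in Ico a t₀ ×ˢ closedBall (0 : EuclideanSpace ℝ (Fin 3)) ρ₁,
      ENNReal.ofReal (cylRadius z.2)⁻¹ ≤ Iϱ) :
    ∫⁻ z in (Ioo a t₀ ×ˢ ball (0 : EuclideanSpace ℝ (Fin 3)) ρ) ∩ {z | Φ z.1 z.2 < l},
        ‖fderiv ℝ (Φ z.1) z.2‖ₑ ^ 2 ≤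
      ENNReal.ofReal (8 / 3 * l ^ 2 *
        ((volume (closedBall (0 : EuclideanSpace ℝ (Fin 3)) ρ₁)).toReal +
          4 * (Cg / (ρ₁ - ρ)) ^ 2 * ((t₀ - a) *
            (volume (closedBall (0 : EuclideanSpace ℝ (Fin 3)) ρ₁)).toReal) +
          2 * (Cg / (ρ₁ - ρ)) * IU.toReal + 4 * (Cg / (ρ₁ - ρ)) * Iϱ.toReal)) := by
  -- ### notation
  set K : Set (EuclideanSpace ℝ (Fin 3)) := closedBall (0 : EuclideanSpace ℝ (Fin 3)) ρ₁ with hK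
  set VK : ℝ := (volume K).toReal with hVK
  set A : ℝ := Cg / (ρ₁ - ρ) with hA
  have hρ₁pos : 0 < ρ₁ := hρ.trans hρ₁
  have hA0 : 0 ≤ A := by rw [hA]; exact div_nonneg hCg0 (by linarith)
  have hKm : MeasurableSet K := measurableSet_closedBall
  have hKfin : volume K < ∞ := measure_closedBall_lt_top
  have hta : 0 < t₀ - a := by linarith
  -- ### the profile, the time factor, the cut-off
  set H : ℝ → ℝ := fun τ => max (2 * l - τ) 0 ^ (3 : ℝ) with hH
  obtain ⟨hH2, hH', hH0, hH'', hHsq, hH2l, hH8, hH6⟩ := cubeProfile_props hl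
  have hHk : ∀ v, k ≤ v → H v = 0 := fun v hv => hH2l v (hlk.trans hv)
  obtain ⟨hΘ1, hΘc, hΘK, hΘ01, hΘone, hΘzero⟩ := radialCutoff_energy_props hρ hρ₁
  set Θ : EuclideanSpace ℝ (Fin 3) → ℝ := radialCutoff ρ ρ₁ with hΘ
  have hΘsupp : tsupport Θ ⊆ ball (0 : EuclideanSpace ℝ (Fin 3)) (2 * R) :=
    hΘK.trans (closedBall_subset_ball hρ₁R)
  have hΘA : ∀ x, ‖fderiv ℝ Θ x‖ ≤ A := hCg
  set η : ℝ → ℝ := fun _ => 1 with hη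
  have hη1 : ContDiff ℝ 1 η := contDiff_const
  have hη0 : ∀ s, 0 ≤ η s := fun _ => zero_le_one
  -- ### Step 1: pointwise bound of the right-hand integrand by a majorant living on `K`
  set S : ℝ × EuclideanSpace ℝ (Fin 3) → ℝ := fun z =>
    4 * η z.1 * (H (Φ z.1 z.2) * ‖gradient Θ z.2‖ ^ 2) +
      η z.1 * (H (Φ z.1 z.2) * inner ℝ (U z.1 z.2) (gradient (fun y => Θ y ^ 2) z.2)) +
      η z.1 * (2 / cylRadius z.2 * (H (Φ z.1 z.2) * fderiv ℝ (fun y => Θ y ^ 2) z.2 (eR z.2))) +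
      |deriv η z.1| * (H (Φ z.1 z.2) * Θ z.2 ^ 2) with hS
  set c₁ : ℝ := 8 * l ^ 3 * (4 * A ^ 2) with hc₁
  set c₂ : ℝ := 8 * l ^ 3 * (2 * A) with hc₂
  set c₃ : ℝ := 8 * l ^ 3 * (4 * A) with hc₃
  have hc₁0 : 0 ≤ c₁ := by positivity
  have hc₂0 : 0 ≤ c₂ := by positivity
  have hc₃0 : 0 ≤ c₃ := by positivity
  set F : ℝ × EuclideanSpace ℝ (Fin 3) → ℝ≥0∞ := fun z =>
    ENNReal.ofReal c₁ + ENNReal.ofReal c₂ * ‖U z.1 z.2‖ₑ +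
      ENNReal.ofReal c₃ * ENNReal.ofReal (cylRadius z.2)⁻¹ with hF
  set G : ℝ × EuclideanSpace ℝ (Fin 3) → ℝ≥0∞ := fun z =>
    ((univ : Set ℝ) ×ˢ K).indicator F z with hG
  have hηz : ∀ s, η s = 1 := fun _ => rfl
  have hdη : ∀ s, deriv η s = 0 := fun s => by rw [hη]; exact deriv_const s 1
  have hSG : ∀ z, ‖S z‖ₑ ≤ G z := by
    intro z
    by_cases hz : z.2 ∈ K
    · have hind : G z = F z := by
        rw [hG]; exact indicator_of_mem (show z ∈ (univ : Set ℝ) ×ˢ K from ⟨mem_univ _, hz⟩) F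
      rw [hind, hF]
      -- real bound `|S z| ≤ c₁ + c₂ ‖U‖ + c₃ ϱ⁻¹`
      have hHle : H (Φ z.1 z.2) ≤ 8 * l ^ 3 := hH8 _ (hΦ0 _ _)
      have hHnn : 0 ≤ H (Φ z.1 z.2) := hH0 _
      have hgΘ : ‖gradient Θ z.2‖ ≤ A := by rw [norm_gradient_eq_norm_fderiv]; exact hΘA _
      have hgΘ2 : ‖gradient (fun y => Θ y ^ 2) z.2‖ ≤ 2 * A := by
        refine (norm_gradient_sq_le hΘ1 z.2).trans ?_
        have h1 : |Θ z.2| ≤ 1 := by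
          rw [abs_of_nonneg (hΘ01 z.2).1]; exact (hΘ01 z.2).2
        calc 2 * |Θ z.2| * ‖fderiv ℝ Θ z.2‖ ≤ 2 * 1 * A := by gcongr; exact hΘA _
          _ = 2 * A := by ring
      have hdΘ2 : |fderiv ℝ (fun y => Θ y ^ 2) z.2 (eR z.2)| ≤ 2 * A := by
        rw [fderiv_sq_apply hΘ1, abs_mul, abs_mul, abs_two, abs_of_nonneg (hΘ01 z.2).1]
        have h1 : |fderiv ℝ Θ z.2 (eR z.2)| ≤ A := by
          have h := ContinuousLinearMap.le_opNorm (fderiv ℝ Θ z.2) (eR z.2)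
          rw [Real.norm_eq_abs] at h
          calc |fderiv ℝ Θ z.2 (eR z.2)| ≤ ‖fderiv ℝ Θ z.2‖ * ‖eR z.2‖ := h
            _ ≤ A * 1 := by gcongr; exacts [hΘA _, norm_eR_le_one _]
            _ = A := mul_one A
        calc 2 * Θ z.2 * |fderiv ℝ Θ z.2 (eR z.2)| ≤ 2 * 1 * A := by
              gcongr; exact (hΘ01 z.2).2
          _ = 2 * A := by ring
      have hρinv : 0 ≤ (cylRadius z.2)⁻¹ := inv_nonneg.2 (cylRadius_nonneg _)
      have h2ρ : |2 / cylRadius z.2| = 2 * (cylRadius z.2)⁻¹ := by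
        rw [div_eq_mul_inv, abs_mul, abs_two, abs_of_nonneg hρinv]
      have hT1 : |4 * η z.1 * (H (Φ z.1 z.2) * ‖gradient Θ z.2‖ ^ 2)| ≤ c₁ := by
        rw [hηz z.1, mul_one, abs_mul, abs_of_nonneg (by norm_num : (0:ℝ) ≤ 4),
          abs_of_nonneg (mul_nonneg hHnn (sq_nonneg _)), hc₁]
        have : ‖gradient Θ z.2‖ ^ 2 ≤ A ^ 2 := pow_le_pow_left₀ (norm_nonneg _) hgΘ 2
        nlinarith [mul_le_mul hHle this (sq_nonneg _) (by positivity)]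
      have hT2 : |η z.1 * (H (Φ z.1 z.2) * inner ℝ (U z.1 z.2) (gradient (fun y => Θ y ^ 2) z.2))|
          ≤ c₂ * ‖U z.1 z.2‖ := by
        rw [hηz z.1, one_mul, abs_mul, abs_of_nonneg hHnn, hc₂]
        have hin : |inner ℝ (U z.1 z.2) (gradient (fun y => Θ y ^ 2) z.2)| ≤ ‖U z.1 z.2‖ * (2 * A) :=
          (abs_real_inner_le_norm _ _).trans (mul_le_mul_of_nonneg_left hgΘ2 (norm_nonneg _))
        calc H (Φ z.1 z.2) * |inner ℝ (U z.1 z.2) (gradient (fun y => Θ y ^ 2) z.2)|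
            ≤ 8 * l ^ 3 * (‖U z.1 z.2‖ * (2 * A)) :=
              mul_le_mul hHle hin (abs_nonneg _) (by positivity)
          _ = 8 * l ^ 3 * (2 * A) * ‖U z.1 z.2‖ := by ring
      have hT3 : |η z.1 * (2 / cylRadius z.2 *
          (H (Φ z.1 z.2) * fderiv ℝ (fun y => Θ y ^ 2) z.2 (eR z.2)))| ≤ c₃ * (cylRadius z.2)⁻¹ := by
        rw [hηz z.1, one_mul, abs_mul, h2ρ, abs_mul, abs_of_nonneg hHnn, hc₃]
        have : H (Φ z.1 z.2) * |fderiv ℝ (fun y => Θ y ^ 2) z.2 (eR z.2)| ≤ 8 * l ^ 3 * (2 * A) :=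
          mul_le_mul hHle hdΘ2 (abs_nonneg _) (by positivity)
        calc 2 * (cylRadius z.2)⁻¹ * (H (Φ z.1 z.2) * |fderiv ℝ (fun y => Θ y ^ 2) z.2 (eR z.2)|)
            ≤ 2 * (cylRadius z.2)⁻¹ * (8 * l ^ 3 * (2 * A)) :=
              mul_le_mul_of_nonneg_left this (by positivity)
          _ = 8 * l ^ 3 * (4 * A) * (cylRadius z.2)⁻¹ := by ring
      have hT4 : |deriv η z.1| * (H (Φ z.1 z.2) * Θ z.2 ^ 2) = 0 := by
        rw [hdη, abs_zero, zero_mul]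
      have hSabs : |S z| ≤ c₁ + c₂ * ‖U z.1 z.2‖ + c₃ * (cylRadius z.2)⁻¹ := by
        rw [hS]
        dsimp only
        rw [hT4, add_zero]
        refine (abs_add_le _ _).trans (add_le_add ((abs_add_le _ _).trans (add_le_add hT1 hT2)) hT3)
      calc ‖S z‖ₑ = ENNReal.ofReal |S z| := by rw [← Real.enorm_eq_ofReal_abs]
        _ ≤ ENNReal.ofReal (c₁ + c₂ * ‖U z.1 z.2‖ + c₃ * (cylRadius z.2)⁻¹) :=
            ENNReal.ofReal_le_ofReal hSabs
        _ = ENNReal.ofReal c₁ + ENNReal.ofReal c₂ * ‖U z.1 z.2‖ₑ +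
              ENNReal.ofReal c₃ * ENNReal.ofReal (cylRadius z.2)⁻¹ := by
            rw [ENNReal.ofReal_add (by positivity) (by positivity),
              ENNReal.ofReal_add (by positivity) (by positivity),
              ENNReal.ofReal_mul hc₂0, ENNReal.ofReal_mul hc₃0, ofReal_norm]
    · -- off `K` everything vanishes
      obtain ⟨hΘ0', hdΘ0, hg2⟩ := hΘzero z.2 hz
      have hg1 : gradient Θ z.2 = 0 := by
        unfold gradient; rw [hdΘ0]; simp
      have hS0 : S z = 0 := by
        rw [hS]
        dsimp only
        rw [hg1, hg2, hΘ0', fderiv_sq_apply hΘ1, hΘ0', hdη]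
        simp
      rw [hS0, enorm_zero]
      exact zero_le
  -- ### Step 2: measurability and integrals of the majorant
  have hIcc_sub : ∀ t₂, t₂ < t₀ → Icc a t₂ ×ˢ K ⊆
      Ioo (-R ^ 2) 0 ×ˢ ball (0 : EuclideanSpace ℝ (Fin 3)) (2 * R) := by
    intro t₂ ht₂
    refine prod_mono (fun s hs => ⟨ha.trans_le hs.1, hs.2.trans_lt (ht₂.trans_le ht₀)⟩)
      (closedBall_subset_ball hρ₁R)
  have hUe : ∀ t₂, t₂ < t₀ → AEMeasurable (fun z : ℝ × EuclideanSpace ℝ (Fin 3) => ‖U z.1 z.2‖ₑ)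
      (volume.restrict (Icc a t₂ ×ˢ K)) := by
    intro t₂ ht₂
    exact (hU.mono_measure (Measure.restrict_mono (hIcc_sub t₂ ht₂) le_rfl)).enorm
  have hρm : Measurable fun z : ℝ × EuclideanSpace ℝ (Fin 3) =>
      ENNReal.ofReal (cylRadius z.2)⁻¹ :=
    ENNReal.measurable_ofReal.comp ((continuous_cylRadius.measurable.comp measurable_snd).inv)
  have hGint : ∀ t₂, a ≤ t₂ → t₂ < t₀ →
      ∫⁻ z in Icc a t₂ ×ˢ (univ : Set (EuclideanSpace ℝ (Fin 3))), G z ≤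
        ENNReal.ofReal c₁ * (ENNReal.ofReal (t₀ - a) * volume K) +
          ENNReal.ofReal c₂ * IU + ENNReal.ofReal c₃ * Iϱ := by
    intro t₂ hat₂ ht₂
    have hprodm : MeasurableSet ((univ : Set ℝ) ×ˢ K) := MeasurableSet.univ.prod hKm
    have h1 : ∫⁻ z in Icc a t₂ ×ˢ (univ : Set (EuclideanSpace ℝ (Fin 3))), G z =
        ∫⁻ z in Icc a t₂ ×ˢ K, F z := by
      rw [hG, lintegral_indicator hprodm, Measure.restrict_restrict hprodm, prod_inter_prod,
        univ_inter, inter_univ]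
    rw [h1]
    have hsplit : ∫⁻ z in Icc a t₂ ×ˢ K, F z =
        ENNReal.ofReal c₁ * volume (Icc a t₂ ×ˢ K) +
          ENNReal.ofReal c₂ * (∫⁻ z in Icc a t₂ ×ˢ K, ‖U z.1 z.2‖ₑ) +
          ENNReal.ofReal c₃ * (∫⁻ z in Icc a t₂ ×ˢ K, ENNReal.ofReal (cylRadius z.2)⁻¹) := by
      rw [hF]
      rw [lintegral_add_right _ (hρm.const_mul _), lintegral_add_left' aemeasurable_const,
        lintegral_const, Measure.restrict_apply_univ, lintegral_const_mul'' _ (hUe t₂ ht₂),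
        lintegral_const_mul _ hρm]
    rw [hsplit]
    have hvol : volume (Icc a t₂ ×ˢ K) ≤ ENNReal.ofReal (t₀ - a) * volume K := by
      calc volume (Icc a t₂ ×ˢ K) ≤ volume (Icc a t₀ ×ˢ K) :=
            measure_mono (prod_mono (Icc_subset_Icc le_rfl ht₂.le) le_rfl)
        _ = ENNReal.ofReal (t₀ - a) * volume K := by
            rw [Measure.volume_eq_prod, Measure.prod_prod, Real.volume_Icc]
    have hsubt : Icc a t₂ ×ˢ K ⊆ Ico a t₀ ×ˢ K := prod_mono (Icc_subset_Ico_right ht₂) le_rfl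
    exact add_le_add (add_le_add (mul_le_mul' le_rfl hvol)
      (mul_le_mul' le_rfl ((lintegral_mono_set hsubt).trans hIU)))
      (mul_le_mul' le_rfl ((lintegral_mono_set hsubt).trans hIϱ))
  -- ### Step 3: the energy inequality at `t₂ ∈ [a, t₀)` and the real bound `Btot`
  set Btot : ℝ := 8 * l ^ 3 * VK + c₁ * ((t₀ - a) * VK) + c₂ * IU.toReal + c₃ * Iϱ.toReal
    with hBtot
  have hMa : ∫ x, H (Φ a x) * Θ x ^ 2 ≤ 8 * l ^ 3 * VK := by
    refine integral_le_of_le_indicator_const hKm hKfin.ne (by positivity) (fun x _ => ?_)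
      (fun x hx => by rw [(hΘzero x hx).1]; simp)
    rw [abs_of_nonneg (mul_nonneg (hH0 _) (sq_nonneg _))]
    have hΘsq : Θ x ^ 2 ≤ 1 := by have := hΘ01 x; nlinarith
    calc H (Φ a x) * Θ x ^ 2 ≤ 8 * l ^ 3 * 1 :=
        mul_le_mul (hH8 _ (hΦ0 _ _)) hΘsq (sq_nonneg _) (by positivity)
      _ = 8 * l ^ 3 := mul_one _
  have hstep : ∀ t₂, a ≤ t₂ → t₂ < t₀ →
      ENNReal.ofReal (3 * l) *
          ∫⁻ z in (Icc a t₂ ×ˢ ball (0 : EuclideanSpace ℝ (Fin 3)) ρ) ∩ {z | Φ z.1 z.2 < l},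
            ‖fderiv ℝ (Φ z.1) z.2‖ₑ ^ 2 ≤ ENNReal.ofReal Btot := by
    intro t₂ hat₂ ht₂
    have ht₂0 : t₂ < 0 := ht₂.trans_le ht₀
    have h' := hEC H hH2 hH' hH0 hH'' hHsq hHk Θ hΘ1 hΘc hΘsupp η hη1 hη0 a t₂ ha hat₂ ht₂0
    have h : ENNReal.ofReal (η t₂ * ∫ x, H (Φ t₂ x) * Θ x ^ 2) +
        ∫⁻ z in Icc a t₂ ×ˢ (univ : Set (EuclideanSpace ℝ (Fin 3))), ENNReal.ofReal
          (1 / 2 * η z.1 * (deriv (deriv H) (Φ z.1 z.2) * ‖gradient (Φ z.1) z.2‖ ^ 2 *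
            Θ z.2 ^ 2)) ≤
        ENNReal.ofReal (η a * (∫ x, H (Φ a x) * Θ x ^ 2) +
          ∫ z in Icc a t₂ ×ˢ (univ : Set (EuclideanSpace ℝ (Fin 3))), S z) := by
      simpa only [hS] using h'
    -- the dissipation dominates `3l ∫∫ |∇Φ|²` on the sublevel set inside `B(ρ)`
    set St : Set (ℝ × EuclideanSpace ℝ (Fin 3)) :=
      (Icc a t₂ ×ˢ ball (0 : EuclideanSpace ℝ (Fin 3)) ρ) ∩ {z | Φ z.1 z.2 < l} with hSt
    have hStm : MeasurableSet St :=
      (measurableSet_Icc.prod measurableSet_ball).inter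
        (measurableSet_lt hΦm measurable_const)
    have hD : ENNReal.ofReal (3 * l) * ∫⁻ z in St, ‖fderiv ℝ (Φ z.1) z.2‖ₑ ^ 2 ≤
        ∫⁻ z in Icc a t₂ ×ˢ (univ : Set (EuclideanSpace ℝ (Fin 3))), ENNReal.ofReal
          (1 / 2 * η z.1 * (deriv (deriv H) (Φ z.1 z.2) * ‖gradient (Φ z.1) z.2‖ ^ 2 *
            Θ z.2 ^ 2)) := by
      rw [← lintegral_const_mul' _ _ ENNReal.ofReal_ne_top]
      refine (setLIntegral_mono' hStm fun z hz => ?_).trans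
        (lintegral_mono_set (inter_subset_left.trans (prod_mono le_rfl (subset_univ _))))
      have hΘ1' : Θ z.2 = 1 := hΘone z.2 hz.1.2
      have hH6' : 6 * l ≤ deriv (deriv H) (Φ z.1 z.2) := hH6 _ (le_of_lt hz.2)
      rw [hηz z.1, hΘ1', norm_gradient_eq_norm_fderiv, ← ofReal_norm,
        ← ENNReal.ofReal_pow (norm_nonneg _), ← ENNReal.ofReal_mul (by positivity)]
      refine ENNReal.ofReal_le_ofReal ?_
      have hg0 : 0 ≤ ‖fderiv ℝ (Φ z.1) z.2‖ ^ 2 := sq_nonneg _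
      nlinarith
    -- the right-hand side is at most `Btot`
    have hR : η a * (∫ x, H (Φ a x) * Θ x ^ 2) +
        (∫ z in Icc a t₂ ×ˢ (univ : Set (EuclideanSpace ℝ (Fin 3))), S z) ≤ Btot := by
      rw [hηz a, one_mul]
      have hfinG : ENNReal.ofReal c₁ * (ENNReal.ofReal (t₀ - a) * volume K) +
          ENNReal.ofReal c₂ * IU + ENNReal.ofReal c₃ * Iϱ ≠ ∞ := by
        refine ENNReal.add_ne_top.2 ⟨ENNReal.add_ne_top.2 ⟨?_, ?_⟩, ?_⟩
        · exact ENNReal.mul_ne_top ENNReal.ofReal_ne_top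
            (ENNReal.mul_ne_top ENNReal.ofReal_ne_top hKfin.ne)
        · exact ENNReal.mul_ne_top ENNReal.ofReal_ne_top hIUfin
        · exact ENNReal.mul_ne_top ENNReal.ofReal_ne_top hIϱfin
      have hS1 : (∫ z in Icc a t₂ ×ˢ (univ : Set (EuclideanSpace ℝ (Fin 3))), S z) ≤
          c₁ * ((t₀ - a) * VK) + c₂ * IU.toReal + c₃ * Iϱ.toReal := by
        have h1 := norm_integral_le_lintegral_norm
          (μ := volume.restrict (Icc a t₂ ×ˢ (univ : Set (EuclideanSpace ℝ (Fin 3))))) S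
        have h2 : ∫⁻ z in Icc a t₂ ×ˢ (univ : Set (EuclideanSpace ℝ (Fin 3))),
            ENNReal.ofReal ‖S z‖ ≤
            ENNReal.ofReal c₁ * (ENNReal.ofReal (t₀ - a) * volume K) +
              ENNReal.ofReal c₂ * IU + ENNReal.ofReal c₃ * Iϱ := by
          refine (lintegral_mono fun z => ?_).trans (hGint t₂ hat₂ ht₂)
          rw [ofReal_norm]; exact hSG z
        calc (∫ z in Icc a t₂ ×ˢ (univ : Set (EuclideanSpace ℝ (Fin 3))), S z)
            ≤ ‖∫ z in Icc a t₂ ×ˢ (univ : Set (EuclideanSpace ℝ (Fin 3))), S z‖ :=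
              Real.le_norm_self _
          _ ≤ (ENNReal.ofReal c₁ * (ENNReal.ofReal (t₀ - a) * volume K) +
              ENNReal.ofReal c₂ * IU + ENNReal.ofReal c₃ * Iϱ).toReal :=
              h1.trans (ENNReal.toReal_mono hfinG h2)
          _ = c₁ * ((t₀ - a) * VK) + c₂ * IU.toReal + c₃ * Iϱ.toReal := by
              rw [ENNReal.toReal_add, ENNReal.toReal_add, ENNReal.toReal_mul, ENNReal.toReal_mul,
                ENNReal.toReal_mul, ENNReal.toReal_mul, ENNReal.toReal_ofReal hc₁0,
                ENNReal.toReal_ofReal hc₂0, ENNReal.toReal_ofReal hc₃0,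
                ENNReal.toReal_ofReal hta.le, hVK]
              · exact ENNReal.mul_ne_top ENNReal.ofReal_ne_top
                  (ENNReal.mul_ne_top ENNReal.ofReal_ne_top hKfin.ne)
              · exact ENNReal.mul_ne_top ENNReal.ofReal_ne_top hIUfin
              · exact ENNReal.add_ne_top.2 ⟨ENNReal.mul_ne_top ENNReal.ofReal_ne_top
                  (ENNReal.mul_ne_top ENNReal.ofReal_ne_top hKfin.ne),
                  ENNReal.mul_ne_top ENNReal.ofReal_ne_top hIUfin⟩
              · exact ENNReal.mul_ne_top ENNReal.ofReal_ne_top hIϱfin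
      rw [hBtot]
      linarith [hMa, hS1]
    calc ENNReal.ofReal (3 * l) * ∫⁻ z in St, ‖fderiv ℝ (Φ z.1) z.2‖ₑ ^ 2
        ≤ ∫⁻ z in Icc a t₂ ×ˢ (univ : Set (EuclideanSpace ℝ (Fin 3))), ENNReal.ofReal
            (1 / 2 * η z.1 * (deriv (deriv H) (Φ z.1 z.2) * ‖gradient (Φ z.1) z.2‖ ^ 2 *
              Θ z.2 ^ 2)) := hD
      _ ≤ ENNReal.ofReal (η t₂ * ∫ x, H (Φ t₂ x) * Θ x ^ 2) +
          ∫⁻ z in Icc a t₂ ×ˢ (univ : Set (EuclideanSpace ℝ (Fin 3))), ENNReal.ofReal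
            (1 / 2 * η z.1 * (deriv (deriv H) (Φ z.1 z.2) * ‖gradient (Φ z.1) z.2‖ ^ 2 *
              Θ z.2 ^ 2)) := le_add_self
      _ ≤ _ := h
      _ ≤ ENNReal.ofReal Btot := ENNReal.ofReal_le_ofReal hR
  -- ### Step 4: `t₂ ↑ t₀`
  obtain ⟨htn, hcover⟩ := setLIntegral_Ioo_prod_inter_le_iSup hat
    (ball (0 : EuclideanSpace ℝ (Fin 3)) ρ) {z | Φ z.1 z.2 < l}
    (fun z => ‖fderiv ℝ (Φ z.1) z.2‖ₑ ^ 2)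
  have hsup : ENNReal.ofReal (3 * l) *
      ∫⁻ z in (Ioo a t₀ ×ˢ ball (0 : EuclideanSpace ℝ (Fin 3)) ρ) ∩ {z | Φ z.1 z.2 < l},
        ‖fderiv ℝ (Φ z.1) z.2‖ₑ ^ 2 ≤ ENNReal.ofReal Btot := by
    refine (mul_le_mul' le_rfl hcover).trans ?_
    rw [ENNReal.mul_iSup]
    exact iSup_le fun n => hstep _ (htn n).1 (htn n).2
  -- ### Step 5: divide by `3l`
  have h3l : ENNReal.ofReal (3 * l) ≠ 0 := (ENNReal.ofReal_pos.2 (by positivity)).ne'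
  have hBtot_eq : (3 * l)⁻¹ * Btot = 8 / 3 * l ^ 2 * (VK + 4 * A ^ 2 * ((t₀ - a) * VK) +
      2 * A * IU.toReal + 4 * A * Iϱ.toReal) := by
    have hY : Btot = 8 * l ^ 3 * (VK + 4 * A ^ 2 * ((t₀ - a) * VK) +
        2 * A * IU.toReal + 4 * A * Iϱ.toReal) := by
      rw [hBtot, hc₁, hc₂, hc₃]; ring
    have hl3 : (3 * l)⁻¹ * (8 * l ^ 3) = 8 / 3 * l ^ 2 := by
      field_simp
    rw [hY, ← mul_assoc, hl3]
  calc ∫⁻ z in (Ioo a t₀ ×ˢ ball (0 : EuclideanSpace ℝ (Fin 3)) ρ) ∩ {z | Φ z.1 z.2 < l},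
        ‖fderiv ℝ (Φ z.1) z.2‖ₑ ^ 2
      = (ENNReal.ofReal (3 * l))⁻¹ * (ENNReal.ofReal (3 * l) *
          ∫⁻ z in (Ioo a t₀ ×ˢ ball (0 : EuclideanSpace ℝ (Fin 3)) ρ) ∩ {z | Φ z.1 z.2 < l},
            ‖fderiv ℝ (Φ z.1) z.2‖ₑ ^ 2) := by
        rw [← mul_assoc, ENNReal.inv_mul_cancel h3l ENNReal.ofReal_ne_top, one_mul]
    _ ≤ (ENNReal.ofReal (3 * l))⁻¹ * ENNReal.ofReal Btot := mul_le_mul' le_rfl hsup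
    _ = ENNReal.ofReal ((3 * l)⁻¹ * Btot) := by
        rw [← ENNReal.ofReal_inv_of_pos (by positivity), ← ENNReal.ofReal_mul (by positivity)]
    _ = _ := by rw [hBtot_eq]

end Summit.NavierStokesRegularity.NavierStokesRegularity.Theorems.AxisymmetricKatoGlobal.EulerScaling

end
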